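import Summits.QuantumFields.BalabanUV.Beta.GAN24.TwoLegChainInstances
import Summits.QuantumFields.BalabanUV.Beta.GAN24.SoftColumnGradKingOneStep

/-!
# `BalabanUV.Beta.GAN24.BackgroundVertexChain` — binder row G-an2-4 ∕ (CONV-C), route R7, road P2: the first chain with a NON-CONSTANT vertex —
# TWO GRADIENT LEGS of `H_k` joined by a vertex LINEAR IN THE BACKGROUND `M̃_k u` sourced at a unit bond `b` (the value of Bałaban's soft column
# `MsoftV = a·𝒢_aQ*` at the vertex point): `K_b^{(n)}(s;s′) = Σ_x η^{d+1} Σ_{ij} (Σ_μ c_{ijμ}·M̃_n((x,μ),b))·∂H_n[i](x;s)·∂H_n[j](x;s′)` obeys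
# BOTH (CONV-C) CLAUSES at `U = 1`, every torus, every `a > 0`, rate `θG(L,½)^k = L^{−k∕4}` — the vertex's bound and transport letters being
# leaf-03's `KH` and gan24-p3-g27's staircase law `HkStaircaseOneStep.norm_MsoftV_sub_stairV_apply_le_lev` (`δHc′·(L⁻¹)^k`) BY NAME

NOT IN PRINT; OUR PROOF ATTEMPT (unit `b2b-balaban-gan24-p2`, gen 31 = prover-b2b-balaban-gan24-p2-g31-0, road-P2 chair of row G-an2-4;
CRUX TEAM (2) under the ruling «YM REDIRECT TOWARDS THE SUMMIT», 2026-08-21).  HONEST FRAMING (cell contract, verbatim): «discharging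
`BetaPertH` makes Bałaban's UV stability UNCONDITIONAL — a real constructive-QFT result; it is NOT the continuum limit and NOT the Clay
problem.»  HONEST DEPENDENCY (verbatim): «continuum YM on T⁴ ⇐ BetaPertH ∧ nine spine estimates (0/9 proved); BetaPertH ⇐ (D1) ∧ (D4) ∧
CAP+tail; G-an2-4 gates asym, D1 and NE2/3/4.»  ABSOLUTE RULE: nothing printed is a hypothesis; no `def … : Prop`, no `sorry`; [folklore]
packaging BY NAME of `GradientVertexChainKing` (F), this lineage's `HkGradientKingRate`, leaf-04's `SoftColumnTwoLevel` (`colOp_eq_Hk_mul_covOp`),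
leaf-03's `SoftColumnSupLetter` (`sum_norm_HkOp_le`, `norm_QGQ_apply_le`), p3-g27's `HkStaircaseOneStep`.  WHICH of an1's rows T1–T3 (if
any) this class realises is NOT claimed (the printed Wilson-Hessian vertices at a background carry plaquette geometry an1∕an2's S1 must supply);
this is the LINEARISED-BACKGROUND × GRADIENT × GRADIENT class at `U = 1`.

## Content (0 sorry)
 * §1 `norm_colOp_apply_le` (`|𝒢_aQ*(X,q)| ≤ KH·a⁻¹`), **`norm_MsoftV_apply_le`** (`|M̃(X,q)| ≤ KH(d)`, every level, torus, `a > 0`),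
   **`norm_MsoftV_sub_par_apply_le_lev`** (`|M̃_{k+1}(X′,b) − M̃_k(parT X′,b)| ≤ δHc′(d,a,L,k)`, p3's law through `stairV_mul_apply`).
 * §2 `bgVtx n M a c b x i j := Σ_μ c i j μ · MsoftV n M a (x,μ) b`; its bound `cnorm c·KH` and transport `cnorm c·δHc′`.
 * §3 **`bg_chain_two_clauses`**: `∃ κ > 0, C ≥ 0, 0 ≤ θ < 1` (θ = θG(L,½)) with (i) `‖K_b^{(n_k)}(y,λ;y′,λ′)‖ ≤ C·e^{−κ|y−y′|_T}` and
   (ii) `‖K_b^{(n_{k+1})} − K_b^{(n_k)}‖ ≤ C·θ^k·e^{−κ|y−y′|_T}`, for every `k`, unit bond `b`, sources `(y,λ), (y′,λ′)` — every torus, `L ≥ 2`, `a > 0`.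
HONEST.  [folklore]; exponent `L^{−1∕4}` from the gradient legs (interpolation); no decay in `b` is claimed (the vertex is bounded, not localised,
in this statement — its localisation `e^{−δ|ȳ(x)−b|}` is leaf-06's RowDecay letters, not used); U = 1; NOT (CONV-C) as typed, NEVER «G-an2-4
closed», NOT NE2, NOT D1, NOT BetaPertH, NOT continuum, NOT Clay.  Text locations only: [Balaban1984PropagatorsI] (1.71) p. 29, (1.100)–(1.103)
p. 35; [King1986] §4 p. 672.
-/

noncomputable section

open scoped BigOperators Matrix
open Finset

namespace Summit.QuantumFields.BalabanUV.Beta.GAN24.BackgroundVertexChain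

open Literature.MathematicalPhysics.QuantumFieldTheory.Balaban1983to89
open Literature.MathematicalPhysics.QuantumFieldTheory.Balaban1983to89.B5Prop11Plancherel (Tor fine)
open Literature.MathematicalPhysics.QuantumFieldTheory.Balaban1983to89.B4TorusKernel.MultiPeriod (torusSupNorm)
open Literature.MathematicalPhysics.QuantumFieldTheory.Balaban1983to89.B4Sect5Proof (latticeConst latticeConst_nonneg)
open Literature.MathematicalPhysics.QuantumFieldTheory.Balaban1983to89.B5Blocks16 (blockOf)
open Literature.MathematicalPhysics.QuantumFieldTheory.Balaban1983to89.B6LowerBound2153Torus (toT rep toT_rep)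
open Literature.MathematicalPhysics.QuantumFieldTheory.Balaban1983to89.B5G183RateUnitTower (lev lev_neZero)
open Literature.MathematicalPhysics.QuantumFieldTheory.Balaban1983to89.B5Hk163Torus (HkOp)
open Literature.MathematicalPhysics.QuantumFieldTheory.Balaban1983to89.B5Hk163Form166 (HkOp_eq_Hk)
open Literature.MathematicalPhysics.QuantumFieldTheory.Balaban1983to89.B5Hk163TorusHolderDecay (CdecD CdecD_nonneg)
open Literature.MathematicalPhysics.QuantumFieldTheory.Balaban1983to89.Beta.FluctuationProjection (Hk)
open Summit.QuantumFields.BalabanUV.T4Continuum.BalabanAveragedTowerModes (par)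
open Summit.QuantumFields.BalabanUV.T4Continuum.BlockPairingGeometry (parT)
open Summit.QuantumFields.BalabanUV.T4Continuum.BalabanLineAverage (CQB CQB_nonneg)
open Summit.QuantumFields.BalabanUV.Beta.GAN24.StaircaseAveragingDefect (stairV)
open Summit.QuantumFields.BalabanUV.Beta.GAN24.AveragedPropagatorTwoLevel (covOp)
open Summit.QuantumFields.BalabanUV.Beta.GAN24.SoftVectorMinimiserTwoLevel (MsoftV)
open Summit.QuantumFields.BalabanUV.Beta.GAN24.SoftColumnTwoLevel (colOp MsoftV_eq_smul_colOp colOp_eq_Hk_mul_covOp)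
open Summit.QuantumFields.BalabanUV.Beta.GAN24.SoftColumnSupLetter (KH KH_nonneg sum_norm_HkOp_le)
open Summit.QuantumFields.BalabanUV.Beta.GAN24.HkKingOneStepSup (KH1s KH1s_nonneg)
open Summit.QuantumFields.BalabanUV.Beta.GAN24.HkStaircaseOneStep (δHc' stairV_mul_apply norm_MsoftV_sub_stairV_apply_le_lev)
open Summit.QuantumFields.BalabanUV.Beta.GAN24.HkKingOneStep (dec dec_pos)
open Summit.QuantumFields.BalabanUV.Beta.GAN24.HkGradientKingRate (thetaG thetaG_pos thetaG_lt_one CG CG_nonneg)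
open Summit.QuantumFields.BalabanUV.Beta.GAN24.SoftColumnGradKingOneStep (norm_covOp_apply_le inv_pow_le_thetaG_pow)
open Summit.QuantumFields.BalabanUV.Beta.GAN24.GradientVertexChainKing (VIdx vtxChain norm_vtxChain_le norm_vtxChain_succ_sub_le_lev)
open Summit.QuantumFields.BalabanUV.Beta.GAN24.TwoLegChainKing (Src)

variable {d : ℕ}

/-! ## §1 The soft column's value: bound and parent law in b05 ∕ road-P2 vocabulary -/

section Column

variable (n : ℕ) [NeZero n] (M : Fin (d + 1) → ℕ) [hM : ∀ μ, NeZero (M μ)] (a : ℝ)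

/-- `|(𝒢_aQ*)(X, q)| ≤ KH(d)·a⁻¹` (`colOp = H_k·c_k`, row sums of `H_k` ≤ `KH`, `|c_k| ≤ a⁻¹`). [cite: Balaban1984PropagatorsI, (1.100)–(1.103) p.35] [folklore] -/
theorem norm_colOp_apply_le (ha : 0 < a) (X : Tor (fine n M) × Fin (d + 1)) (q : Src M) : ‖colOp n M a X q‖ ≤ KH d * a⁻¹ := by
  rw [colOp_eq_Hk_mul_covOp n M a (Nat.one_le_iff_ne_zero.mpr (NeZero.ne n)) ha, Matrix.mul_apply, ← HkOp_eq_Hk]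
  calc ‖∑ j, HkOp n M X j * covOp n M a j q‖ ≤ ∑ j, ‖HkOp n M X j * covOp n M a j q‖ := norm_sum_le _ _
    _ ≤ ∑ j, ‖HkOp n M X j‖ * a⁻¹ := Finset.sum_le_sum fun j _ => by
        rw [norm_mul]; exact mul_le_mul_of_nonneg_left (norm_covOp_apply_le n M a ha j q) (norm_nonneg _)
    _ = (∑ j, ‖HkOp n M X j‖) * a⁻¹ := by rw [Finset.sum_mul]
    _ ≤ KH d * a⁻¹ := mul_le_mul_of_nonneg_right (sum_norm_HkOp_le M n X) (inv_nonneg.mpr ha.le)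

/-- **`|M̃(X, q)| ≤ KH(d)`** — the soft column `MsoftV = a•colOp` is bounded uniformly in the level, the torus and `a > 0`. [folklore] -/
theorem norm_MsoftV_apply_le (ha : 0 < a) (X : Tor (fine n M) × Fin (d + 1)) (q : Src M) : ‖MsoftV n M a X q‖ ≤ KH d := by
  rw [MsoftV_eq_smul_colOp, Matrix.smul_apply, smul_eq_mul, norm_mul, Complex.norm_real, Real.norm_of_nonneg ha.le]
  calc a * ‖colOp n M a X q‖ ≤ a * (KH d * a⁻¹) := mul_le_mul_of_nonneg_left (norm_colOp_apply_le n M a ha X q) ha.le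
    _ = KH d := by field_simp

end Column

section ColumnStep

variable (L : ℕ) [NeZero L] (M : Fin (d + 1) → ℕ) [hM : ∀ μ, NeZero (M μ)] (a : ℝ)

/-- **the soft column's parent law in `par` form**: `|M̃_{k+1}(X′, q) − M̃_k(parT X′, q)| ≤ δHc′(d,a,L,k)` (p3-g27's
`norm_MsoftV_sub_stairV_apply_le_lev` through `stairV_mul_apply`: road P2's staircase IS King's parent pull-back). [folklore] -/
theorem norm_MsoftV_sub_par_apply_le_lev (ha : 0 < a) (k : ℕ) (X' : Tor (fine (L * lev L k) M) × Fin (d + 1)) (q : Src M) :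
    ‖MsoftV (L * lev L k) M a X' q - MsoftV (lev L k) M a (parT (lev L k) L M X') q‖ ≤ δHc' d a L k := by
  have h := norm_MsoftV_sub_stairV_apply_le_lev L M a ha k X' q
  rwa [Matrix.sub_apply, stairV_mul_apply] at h

end ColumnStep

/-! ## §2 The background-linear vertex -/

section Vertex

variable (n : ℕ) [NeZero n] (M : Fin (d + 1) → ℕ) [hM : ∀ μ, NeZero (M μ)] (a : ℝ)

/-- the ℓ¹ size of the structure tensor. [folklore] -/
def cnorm (c : VIdx d → VIdx d → Fin (d + 1) → ℂ) : ℝ := ∑ i : VIdx d, ∑ j : VIdx d, ∑ μ : Fin (d + 1), ‖c i j μ‖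

/-- `0 ≤ cnorm c`. [folklore] -/
theorem cnorm_nonneg (c : VIdx d → VIdx d → Fin (d + 1) → ℂ) : 0 ≤ cnorm c :=
  Finset.sum_nonneg fun _ _ => Finset.sum_nonneg fun _ _ => Finset.sum_nonneg fun _ _ => norm_nonneg _

/-- a single component is bounded by the ℓ¹ size. [folklore] -/
theorem sum_norm_le_cnorm (c : VIdx d → VIdx d → Fin (d + 1) → ℂ) (i j : VIdx d) : ∑ μ : Fin (d + 1), ‖c i j μ‖ ≤ cnorm c := by
  unfold cnorm
  exact (Finset.single_le_sum (f := fun j => ∑ μ : Fin (d + 1), ‖c i j μ‖) (fun _ _ => Finset.sum_nonneg fun _ _ => norm_nonneg _)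
      (Finset.mem_univ j)).trans
    (Finset.single_le_sum (f := fun i => ∑ j : VIdx d, ∑ μ : Fin (d + 1), ‖c i j μ‖)
      (fun _ _ => Finset.sum_nonneg fun _ _ => Finset.sum_nonneg fun _ _ => norm_nonneg _) (Finset.mem_univ i))

/-- **the background-linear vertex** `bgVtx c b x i j := Σ_μ c i j μ · M̃_n((x,μ), b)` — a structure tensor contracted with the VALUE of the soft
column sourced at the unit bond `b` at the vertex point. [folklore] -/
def bgVtx (c : VIdx d → VIdx d → Fin (d + 1) → ℂ) (b : Src M) (x : Tor (fine n M)) (i j : VIdx d) : ℂ :=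
  ∑ μ : Fin (d + 1), c i j μ * MsoftV n M a (x, μ) b

/-- the vertex bound: `|bgVtx(x,i,j)| ≤ cnorm c · KH(d)`. [folklore] -/
theorem norm_bgVtx_le (ha : 0 < a) (c : VIdx d → VIdx d → Fin (d + 1) → ℂ) (b : Src M) (x : Tor (fine n M)) (i j : VIdx d) :
    ‖bgVtx n M a c b x i j‖ ≤ cnorm c * KH d := by
  unfold bgVtx
  calc _ ≤ ∑ μ, ‖c i j μ * MsoftV n M a (x, μ) b‖ := norm_sum_le _ _
    _ ≤ ∑ μ, ‖c i j μ‖ * KH d := Finset.sum_le_sum fun μ _ => by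
        rw [norm_mul]; exact mul_le_mul_of_nonneg_left (norm_MsoftV_apply_le n M a ha (x, μ) b) (norm_nonneg _)
    _ = (∑ μ, ‖c i j μ‖) * KH d := by rw [Finset.sum_mul]
    _ ≤ cnorm c * KH d := mul_le_mul_of_nonneg_right (sum_norm_le_cnorm c i j) (KH_nonneg d)

end Vertex

section VertexStep

variable (L : ℕ) [NeZero L] (M : Fin (d + 1) → ℕ) [hM : ∀ μ, NeZero (M μ)] (a : ℝ)

/-- the vertex transports against King's parent: `|bgVtx_{k+1}(x′) − bgVtx_k(par x′)| ≤ cnorm c · δHc′(d,a,L,k)`. [folklore] -/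
theorem norm_bgVtx_sub_le_lev (ha : 0 < a) (c : VIdx d → VIdx d → Fin (d + 1) → ℂ) (b : Src M) (k : ℕ)
    (x' : Tor (fine (L * lev L k) M)) (i j : VIdx d) :
    ‖bgVtx (L * lev L k) M a c b x' i j - bgVtx (lev L k) M a c b (par (lev L k) L M x') i j‖ ≤ cnorm c * δHc' d a L k := by
  unfold bgVtx
  rw [← Finset.sum_sub_distrib]
  have hδ : 0 ≤ δHc' d a L k :=
    (norm_nonneg _).trans (norm_MsoftV_sub_par_apply_le_lev L M a ha k (x', 0) b)
  calc _ ≤ ∑ μ, ‖c i j μ * MsoftV (L * lev L k) M a (x', μ) b - c i j μ * MsoftV (lev L k) M a (par (lev L k) L M x', μ) b‖ := norm_sum_le _ _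
    _ ≤ ∑ μ, ‖c i j μ‖ * δHc' d a L k := Finset.sum_le_sum fun μ _ => by
        rw [← mul_sub, norm_mul]
        exact mul_le_mul_of_nonneg_left (norm_MsoftV_sub_par_apply_le_lev L M a ha k (x', μ) b) (norm_nonneg _)
    _ = (∑ μ, ‖c i j μ‖) * δHc' d a L k := by rw [Finset.sum_mul]
    _ ≤ cnorm c * δHc' d a L k := mul_le_mul_of_nonneg_right (sum_norm_le_cnorm c i j) hδ

end VertexStep

/-! ## §3 Both clauses for the background-vertex chain -/

section Chain

variable (L : ℕ) [NeZero L] (M : Fin (d + 1) → ℕ) [hM : ∀ μ, NeZero (M μ)] (a : ℝ)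

/-- **TWO GRADIENT LEGS OF `H_k` + A VERTEX LINEAR IN THE BACKGROUND `M̃_k u` SOURCED AT A UNIT BOND: BOTH (CONV-C) CLAUSES AT `U = 1`** (every
torus, `L ≥ 2`, `a > 0`; θ = θG(L,½) = L^{−1∕4}): there are `κ > 0`, `C ≥ 0`, `0 ≤ θ < 1` (functions of `d, L, a, c`) with, for every level `k`,
unit bond `b`, sources `(y,λ), (y′,λ′)`:
 (i) `‖K_b^{(n_k)}(y,λ;y′,λ′)‖ ≤ C·e^{−κ|y−y′|_T}`;  (ii) `‖K_b^{(n_{k+1})}(y,λ;y′,λ′) − K_b^{(n_k)}(y,λ;y′,λ′)‖ ≤ C·θ^k·e^{−κ|y−y′|_T}`,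
where `K_b^{(n)} = vtxChain n M (bgVtx n M a c b)`. [cite: King1986, §4 p.672 (Leibniz); Balaban1984PropagatorsI, (1.63) p.28, (1.71) p.29] [folklore] -/
theorem bg_chain_two_clauses (hL : 2 ≤ L) (ha : 0 < a) (c : VIdx d → VIdx d → Fin (d + 1) → ℂ) :
    ∃ κ C θ : ℝ, 0 < κ ∧ 0 ≤ C ∧ 0 ≤ θ ∧ θ < 1 ∧
      (∀ (k : ℕ) (b : Src M) (y y' : Fin (d + 1) → ℤ) (lam lam' : Fin (d + 1)),
        ‖vtxChain (lev L k) M (bgVtx (lev L k) M a c b) (toT M y, lam) (toT M y', lam')‖ ≤ C * Real.exp (-(κ * torusSupNorm M (y - y')))) ∧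
      (∀ (k : ℕ) (b : Src M) (y y' : Fin (d + 1) → ℤ) (lam lam' : Fin (d + 1)),
        ‖vtxChain (L * lev L k) M (bgVtx (L * lev L k) M a c b) (toT M y, lam) (toT M y', lam')
            - vtxChain (lev L k) M (bgVtx (lev L k) M a c b) (toT M y, lam) (toT M y', lam')‖
          ≤ C * thetaG L (1/2) ^ k * Real.exp (-(κ * torusSupNorm M (y - y')))) := by
  have hL1 : 1 ≤ L := le_trans (by norm_num) hL
  have hL0 : (0 : ℝ) < L := by exact_mod_cast hL1
  set B : ℝ := cnorm c * KH d with hB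
  have hB0 : 0 ≤ B := mul_nonneg (cnorm_nonneg c) (KH_nonneg d)
  have hC : 0 ≤ CdecD d := CdecD_nonneg
  have hCG := CG_nonneg d (1/2) L
  have hlc : 0 ≤ latticeConst (d + 1) (dec d / 2) := latticeConst_nonneg _ (half_pos (dec_pos d)).le
  -- the vertex transport constant: `cnorm c·δHc′(k) = cnorm c·(a·KH·CQB + KH1s)·(L⁻¹)^k ≤ E0·θG^k`
  set E0 : ℝ := cnorm c * (a * KH d * CQB (d + 1) a + KH1s d) with hE0
  have hE0' : 0 ≤ E0 := by
    have := KH_nonneg d; have := KH1s_nonneg d; have := CQB_nonneg (d + 1) a; have := cnorm_nonneg c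
    positivity
  set C1 : ℝ := ((d : ℝ) + 1) ^ 4 * B * CdecD d ^ 2 * latticeConst (d + 1) (dec d / 2)
  set C2 : ℝ := ((d : ℝ) + 1) ^ 4 * (2 * B * CdecD d * CG d (1/2) L + CdecD d ^ 2 * E0) * latticeConst (d + 1) (dec d / 2)
  have hC1 : 0 ≤ C1 := by positivity
  have hC2 : 0 ≤ C2 := by positivity
  refine ⟨dec d / 2, max C1 C2, thetaG L (1/2), half_pos (dec_pos d), le_max_of_le_left hC1, (thetaG_pos hL1 _).le,
    thetaG_lt_one hL (by norm_num), ?_, ?_⟩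
  · intro k b y y' lam lam'
    exact (norm_vtxChain_le (lev L k) M (bgVtx (lev L k) M a c b) (fun x i j => norm_bgVtx_le (lev L k) M a ha c b x i j) y y' lam lam').trans
      (mul_le_mul_of_nonneg_right (le_max_left _ _) (Real.exp_pos _).le)
  · intro k b y y' lam lam'
    have hθk : 0 ≤ thetaG L (1/2) ^ k := pow_nonneg (thetaG_pos hL1 _).le k
    -- the transport letter at level k, dominated by `E0·θG^k`
    have hεm : ∀ x' i j, ‖bgVtx (L * lev L k) M a c b x' i j - bgVtx (lev L k) M a c b (par (lev L k) L M x') i j‖ ≤ E0 * thetaG L (1/2) ^ k := by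
      intro x' i j
      refine (norm_bgVtx_sub_le_lev L M a ha c b k x' i j).trans ?_
      rw [δHc', hE0, ← mul_assoc]
      exact mul_le_mul_of_nonneg_left (inv_pow_le_thetaG_pow hL1 k (α := 1/2) (by norm_num)) hE0'
    have h := norm_vtxChain_succ_sub_le_lev L M hL k (bgVtx (L * lev L k) M a c b) (bgVtx (lev L k) M a c b) (B := B) (εm := E0 * thetaG L (1/2) ^ k)
      (fun x i j => norm_bgVtx_le (L * lev L k) M a ha c b x i j) (fun x i j => norm_bgVtx_le (lev L k) M a ha c b x i j) hεm y y' lam lam'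
      (α := 1/2) (by norm_num) (by norm_num)
    refine h.trans ?_
    have e : ((d : ℝ) + 1) ^ 4 * (2 * B * CdecD d * (CG d (1/2) L * thetaG L (1/2) ^ k) + CdecD d ^ 2 * (E0 * thetaG L (1/2) ^ k))
          * latticeConst (d + 1) (dec d / 2) = C2 * thetaG L (1/2) ^ k := by ring
    rw [e]
    exact mul_le_mul_of_nonneg_right (mul_le_mul_of_nonneg_right (le_max_right _ _) hθk) (Real.exp_pos _).le

end Chain

end Summit.QuantumFields.BalabanUV.Beta.GAN24.BackgroundVertexChain

end
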